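import Literature.Geometry.GeometricMeasureTheory.CurrentsWeakCompactness
import Literature.Geometry.GeometricMeasureTheory.CurrentsVariationMeasure
import Literature.Geometry.GeometricMeasureTheory.CurrentsAdmissiblePushforward
import HarnessLib

/-!
# Weak sequential compactness of currents with locally bounded masses

The local form of the Banach–Alaoglu step of [Federer1969, 4.2.17 (1)], used in
[Chirka1989, §16.1 Prop. 1 (2)] ("the existence of a convergent subsequence clearly follows from …
the local uniform boundedness of the masses"): on an open subset `Ω` of a finite-dimensional real
normed space, a sequence of currents `Tᵢ` whose variation measures are uniformly bounded on each
compact `K ⊆ Ω` (`‖Tᵢ‖(K) ≤ M_K < ∞`) has a weakly convergent subsequence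
(`Current.exists_subseq_tendsto_of_variation_le`).

Proof: take a compact exhaustion `K_j` of `Ω` (`exists_compact_exhaustion`), relatively compact
open neighbourhoods `V_j ⊇ K_j` in `Ω` and smooth cut-offs `χ_j ∈ [0,1]`, `χ_j = 1` on `K_j`,
`χ_j = 0` off `V_j`; the countable family `χ_j · d_k` (`d_k` a sup-norm dense sequence of test
forms, `TestFunction.exists_countable_sup_dense`) is supported compact-wise with uniform bounds
`|Tᵢ(χ_j d_k)| ≤ ‖Tᵢ‖(V̄_j) ‖d_k‖_∞` (`Current.abs_apply_le_mul_toReal_variation`), so the diagonal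
argument of `Current.exists_subseq_tendsto_of_mass_le` runs; a form `φ` supported in `K_j` equals
`χ_j φ` and is approximated by `χ_j d_k` inside `V̄_j`, which gives the Cauchy property; the limit
functional is bounded by `‖·‖_∞` on each `𝓓_K`, hence a current (`TestFunction.mkCLM`).

Theorems only; no new definitions, no named facts.

## References

* [Federer1969] H. Federer, *Geometric Measure Theory*, Springer 1969, 4.1.5, 4.1.7, 4.2.17 (1).
* [Chirka1989] E. M. Chirka, *Complex Analytic Sets*, Kluwer 1989, §16.1 Prop. 1 (2), p. 207.
-/

noncomputable section

open scoped Distributions ENNReal NNReal Topology BoundedContinuousFunction Manifold ContDiff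
open MeasureTheory TopologicalSpace Set Filter

namespace Literature.Geometry.GeometricMeasureTheory

-- Nested operator-norm instances on (duals of) `E [⋀^Fin m]→L[ℝ] ℝ`, as in `Currents.lean`.
set_option maxSynthPendingDepth 2

variable {E : Type*} [NormedAddCommGroup E] [NormedSpace ℝ E] [FiniteDimensional ℝ E]
  [MeasurableSpace E] [BorelSpace E] {Ω : Opens E} {m : ℕ}

/-- **`|T(φ)| ≤ c · ‖T‖(K)`** for a form `φ` supported in `K` with `‖φ‖ ≤ c` pointwise and
`‖T‖(K) < ∞` (Federer's `T(φ) ≤ ‖T‖(spt φ) · sup ‖φ‖`). [cite: Federer1969, 4.1.5] -/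
theorem Current.abs_apply_le_mul_toReal_variation (T : Current Ω m) {K : Set E}
    (hK : T.variation K ≠ ⊤) {φ : TestForm Ω m} (hφK : tsupport ⇑φ ⊆ K) {c : ℝ} (hc : 0 ≤ c)
    (hφ : ∀ x, ‖φ x‖ ≤ c) : |T φ| ≤ c * (T.variation K).toReal := by
  rcases hc.eq_or_lt with rfl | hc
  · have h0 : φ = 0 := TestFunction.ext fun x => by simpa using hφ x
    rw [h0, map_zero, abs_zero, zero_mul]
  -- scale to comass `≤ 1`
  have key : ∀ ψ : TestForm Ω m, tsupport ⇑ψ ⊆ K → (∀ x, ‖ψ x‖ ≤ c) →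
      T ψ ≤ c * (T.variation K).toReal := by
    intro ψ hψK hψ
    have hsm : ∀ x, (c⁻¹ • ψ) x = c⁻¹ • ψ x := fun x => rfl
    have h1 : ∀ x, ‖(c⁻¹ • ψ) x‖ ≤ 1 := fun x => by
      rw [hsm, norm_smul, norm_inv, Real.norm_of_nonneg hc.le]
      exact (mul_le_mul_of_nonneg_left (hψ x) (inv_nonneg.2 hc.le)).trans
        (by rw [inv_mul_cancel₀ hc.ne'])
    have h2 : tsupport ⇑(c⁻¹ • ψ) ⊆ K := by
      refine (closure_mono fun x hx => ?_).trans hψK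
      intro h
      exact hx (by rw [hsm, h, smul_zero])
    have h3 := (T.ofReal_apply_le_variation h1).trans (measure_mono h2)
    rw [map_smul, smul_eq_mul, ENNReal.ofReal_le_iff_le_toReal hK] at h3
    exact (inv_mul_le_iff₀ hc).1 h3
  have hneg : ∀ x, (-φ) x = -φ x := fun x => rfl
  have hsupp : tsupport ⇑(-φ) ⊆ K := by
    refine (closure_mono fun x hx => ?_).trans hφK
    intro h
    exact hx (by rw [hneg, h, neg_zero])
  have h₁ := key φ hφK hφ
  have h₂ := key (-φ) hsupp fun x => by rw [hneg, norm_neg]; exact hφ x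
  rw [map_neg] at h₂
  exact abs_le.2 ⟨by linarith, h₁⟩

omit [MeasurableSpace E] [BorelSpace E] in
/-- Second countability of the fibre of `m`-covectors over a finite-dimensional space (it is
finite-dimensional). [folklore] -/
private theorem secondCountableTopology_covector' : SecondCountableTopology (Covector E m) := by
  let L : (Covector E m) →ₗ[ℝ] MultilinearMap ℝ (fun _ : Fin m => E) ℝ :=
    { toFun := fun f => f.toContinuousMultilinearMap.toMultilinearMap
      map_add' := fun _ _ => rfl
      map_smul' := fun _ _ => rfl }
  have hL : Function.Injective L := fun f g h =>
    ContinuousAlternatingMap.ext fun v => (DFunLike.congr_fun h v : _)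
  haveI : FiniteDimensional ℝ (Covector E m) := Module.Finite.of_injective L hL
  haveI : ProperSpace (Covector E m) := FiniteDimensional.proper ℝ _
  infer_instance

/-- **Weak sequential compactness of currents with locally bounded masses**: if
`‖Tᵢ‖(K) ≤ M_K < ∞` for every compact `K ⊆ Ω`, uniformly in `i`, then a subsequence of `(Tᵢ)`
converges weakly (`Tᵢ(φ) → T'(φ)` for every test form `φ`) to a current `T'` on `Ω` — the
Banach–Alaoglu argument of `Current.exists_subseq_tendsto_of_mass_le` localised by a compact
exhaustion and smooth cut-offs. [cite: Federer1969, 4.2.17 (1); Chirka1989, §16.1 Prop. 1 (2), p. 207] -/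
theorem Current.exists_subseq_tendsto_of_variation_le (T : ℕ → Current Ω m)
    (hT : ∀ K : Set E, IsCompact K → K ⊆ (Ω : Set E) → ∃ M : ℝ≥0∞, M < ⊤ ∧
      ∀ i, (T i).variation K ≤ M) :
    ∃ (T' : Current Ω m) (ι : ℕ → ℕ), StrictMono ι ∧
      ∀ φ, Tendsto (fun j => T (ι j) φ) atTop (𝓝 (T' φ)) := by
  haveI : SecondCountableTopology (Covector E m) := secondCountableTopology_covector'
  /- exhaustion and cut-offs -/
  obtain ⟨K, hKc, hKΩ, hKabs⟩ := exists_compact_exhaustion Ω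
  have hV : ∀ j, ∃ V : Set E, IsOpen V ∧ K j ⊆ V ∧ closure V ⊆ (Ω : Set E) ∧
      IsCompact (closure V) := fun j =>
    exists_open_between_and_isCompact_closure (hKc j) Ω.isOpen (hKΩ j)
  choose V hVo hKV hVΩ hVc using hV
  have hχ : ∀ j, ∃ χ : E → ℝ, ContDiff ℝ ∞ χ ∧ (∀ x ∈ K j, χ x = 1) ∧ (∀ x, x ∉ V j → χ x = 0) ∧
      ∀ x, χ x ∈ Icc (0 : ℝ) 1 := by
    intro j
    obtain ⟨f, hf0, hf1, hf01⟩ := exists_contMDiffMap_zero_one_of_isClosed 𝓘(ℝ, E) (n := (⊤ : ℕ∞))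
      (hVo j).isClosed_compl (hKc j).isClosed (disjoint_compl_left_iff_subset.2 (hKV j))
    exact ⟨f, contMDiff_iff_contDiff.1 f.contMDiff, fun x hx => hf1 hx, fun x hx => hf0 hx, hf01⟩
  choose χ hχs hχ1 hχ0 hχ01 using hχ
  have hχn : ∀ j x, ‖χ j x‖ ≤ 1 := fun j x => by
    rw [Real.norm_eq_abs, abs_le]
    exact ⟨by linarith [(hχ01 j x).1], (hχ01 j x).2⟩
  have hχsupp : ∀ j, tsupport (χ j) ⊆ closure (V j) := fun j =>
    closure_mono fun x hx => by_contra fun h => hx (hχ0 j x h)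
  /- the local constants -/
  choose M hMtop hM using fun j => hT (closure (V j)) (hVc j) (hVΩ j)
  have hvar : ∀ i j, (T i).variation (closure (V j)) ≠ ⊤ := fun i j =>
    ne_top_of_le_ne_top (hMtop j).ne (hM j i)
  have hbound : ∀ i j (φ : TestForm Ω m), tsupport ⇑φ ⊆ closure (V j) → ∀ {η : ℝ}, 0 ≤ η →
      (∀ x, ‖φ x‖ ≤ η) → |T i φ| ≤ η * (M j).toReal := by
    intro i j φ hφ η hη hφη
    exact ((T i).abs_apply_le_mul_toReal_variation (hvar i j) hφ hη hφη).trans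
      (mul_le_mul_of_nonneg_left (ENNReal.toReal_mono (hMtop j).ne (hM j i)) hη)
  /- multiplication of a test form by `χ j` -/
  have hmul : ∀ j (φ : TestForm Ω m), ∃ ψ : TestForm Ω m, (∀ x, ψ x = χ j x • φ x) ∧
      tsupport ⇑ψ ⊆ closure (V j) := fun j φ =>
    ⟨⟨fun x => χ j x • φ x, (hχs j).smul φ.contDiff, φ.hasCompactSupport.smul_left (f := χ j),
      (tsupport_smul_subset_right (fun x => χ j x) ⇑φ).trans φ.tsupport_subset⟩, fun _ => rfl,
      (tsupport_smul_subset_left (fun x => χ j x) ⇑φ).trans (hχsupp j)⟩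
  choose mulχ hmulχ hmulχs using hmul
  /- a countable sup-dense family, localised -/
  obtain ⟨D, hDc, hD⟩ := TestFunction.exists_countable_sup_dense (F := Covector E m) Ω ⊤
  have hDne : D.Nonempty := by
    obtain ⟨d, hd, -⟩ := hD 0 1 one_pos
    exact ⟨d, hd⟩
  obtain ⟨d, rfl⟩ := hDc.exists_eq_range hDne
  set e : ℕ → TestForm Ω m := fun n => mulχ (Nat.unpair n).1 (d (Nat.unpair n).2) with he
  set b : ℕ → ℝ := fun n => (‖(e n : E →ᵇ Covector E m)‖ + 1) * (M (Nat.unpair n).1).toReal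
    with hb
  have hbn : ∀ i n, |T i (e n)| ≤ b n := fun i n =>
    hbound i _ (e n) (hmulχs _ _) (by positivity) fun x =>
      (BoundedContinuousFunction.norm_coe_le_norm (e n : E →ᵇ Covector E m) x).trans (by linarith)
  /- the diagonal argument -/
  obtain ⟨v, hv⟩ : ∃ v : ℕ → ℕ → ℝ, ∀ i n, v i n = T i (e n) := ⟨_, fun _ _ => rfl⟩
  have hvS : ∀ i, v i ∈ Set.pi univ fun n => Icc (-(b n)) (b n) :=
    fun i n _ => by rw [hv]; exact abs_le.1 (hbn i n)
  obtain ⟨a, -, ι, hι, hlim⟩ := (isCompact_univ_pi fun n => isCompact_Icc).isSeqCompact hvS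
  have hlimk : ∀ n, Tendsto (fun j => T (ι j) (e n)) atTop (𝓝 (a n)) := fun n => by
    have h := tendsto_pi_nhds.1 hlim n
    simp only [Function.comp_def, hv] at h
    exact h
  /- every `Tᵢ(φ)` along `ι` is Cauchy -/
  have hcauchy : ∀ φ : TestForm Ω m, CauchySeq fun j => T (ι j) φ := by
    intro φ
    obtain ⟨j, hj⟩ := hKabs _ φ.hasCompactSupport φ.tsupport_subset
    set c' : ℝ := (M j).toReal with hc'
    have hc'0 : 0 ≤ c' := ENNReal.toReal_nonneg
    have hφχ : ∀ x, χ j x • φ x = φ x := fun x => by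
      by_cases hx : x ∈ K j
      · rw [hχ1 j x hx, one_smul]
      · rw [image_eq_zero_of_notMem_tsupport fun h => hx (hj h), smul_zero]
    refine Metric.cauchySeq_iff.2 fun ε hε => ?_
    obtain ⟨η, hη0, hηε⟩ : ∃ η : ℝ, 0 < η ∧ 2 * c' * η + η < ε := by
      refine ⟨ε / (2 * c' + 2), div_pos hε (by linarith), ?_⟩
      have h1 : (2 * c' + 2) * (ε / (2 * c' + 2)) = ε := by field_simp
      nlinarith [div_pos hε (show (0 : ℝ) < 2 * c' + 2 by linarith)]
    obtain ⟨_, ⟨k, rfl⟩, hk⟩ := hD φ η hη0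
    set n : ℕ := Nat.pair j k with hn
    have hen : ∀ x, e n x = χ j x • d k x := fun x => by
      simp only [he, hn, Nat.unpair_pair]
      exact hmulχ j (d k) x
    have hens : tsupport ⇑(e n) ⊆ closure (V j) := by
      simp only [he, hn, Nat.unpair_pair]
      exact hmulχs j (d k)
    have hk' : ∀ x, ‖(φ - e n) x‖ ≤ η := fun x => by
      rw [sub_apply, ← hφχ x, hen x, ← smul_sub, norm_smul]
      calc ‖χ j x‖ * ‖φ x - d k x‖ ≤ 1 * η :=
            mul_le_mul (hχn j x) (hk x) (norm_nonneg _) zero_le_one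
        _ = η := one_mul η
    have hsuppdiff : tsupport ⇑(φ - e n) ⊆ closure (V j) := by
      refine closure_minimal (fun x hx => ?_) isClosed_closure
      by_contra h
      have h1 : φ x = 0 :=
        image_eq_zero_of_notMem_tsupport fun h' => h (subset_closure (hKV j (hj h')))
      have h2 : e n x = 0 := image_eq_zero_of_notMem_tsupport fun h' => h (hens h')
      exact hx (by rw [sub_apply, h1, h2, sub_zero])
    have hdiff : ∀ i, |T i (φ - e n)| ≤ η * c' := fun i => hbound i j _ hsuppdiff hη0.le hk'
    obtain ⟨N, hN⟩ := Metric.cauchySeq_iff.1 (hlimk n).cauchySeq η hη0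
    refine ⟨N, fun p hp q hq => ?_⟩
    have h1 := hdiff (ι p)
    have h2 := hdiff (ι q)
    have h3 := hN p hp q hq
    rw [Real.dist_eq] at h3 ⊢
    have e1 : T (ι p) φ - T (ι q) φ =
        T (ι p) (φ - e n) + (T (ι p) (e n) - T (ι q) (e n)) - T (ι q) (φ - e n) := by
      simp only [map_sub]; ring
    rw [e1]
    calc |T (ι p) (φ - e n) + (T (ι p) (e n) - T (ι q) (e n)) - T (ι q) (φ - e n)|
        ≤ |T (ι p) (φ - e n)| + |T (ι p) (e n) - T (ι q) (e n)| + |T (ι q) (φ - e n)| :=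
          (abs_sub _ _).trans (add_le_add (abs_add_le _ _) le_rfl)
      _ < ε := by nlinarith
  choose L hL using fun φ => cauchySeq_tendsto_of_complete (hcauchy φ)
  /- the limit functional is linear and locally bounded, hence a current -/
  have hLadd : ∀ φ ψ, L (φ + ψ) = L φ + L ψ := fun φ ψ =>
    tendsto_nhds_unique (hL (φ + ψ)) (by simpa only [map_add] using (hL φ).add (hL ψ))
  have hLsmul : ∀ (r : ℝ) φ, L (r • φ) = r • L φ := fun r φ =>
    tendsto_nhds_unique (hL (r • φ)) (by simpa only [map_smul] using (hL φ).const_smul r)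
  have hLbound : ∀ j (φ : TestForm Ω m), tsupport ⇑φ ⊆ closure (V j) → ∀ c : ℝ, 0 ≤ c →
      (∀ y, ‖φ y‖ ≤ c) → |L φ| ≤ c * (M j).toReal := fun j φ hφ c hc hφc =>
    le_of_tendsto' ((continuous_abs.tendsto _).comp (hL φ)) fun i => hbound (ι i) j φ hφ hc hφc
  let T' : Current Ω m := TestFunction.mkCLM ℝ L hLadd hLsmul fun K₀ hK₀ => by
      obtain ⟨j₀, hj₀⟩ := hKabs (K₀ : Set E) K₀.isCompact hK₀
      let ℓ : 𝓓_{K₀}(E, Covector E m) →ₗ[ℝ] ℝ :=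
        { toFun := fun ψ => L (TestFunction.ofSupportedInCLM ℝ hK₀ ψ)
          map_add' := fun ψ ψ' => by rw [map_add, hLadd]
          map_smul' := fun c ψ => by rw [map_smul, hLsmul]; rfl }
      have hcont : Continuous ℓ :=
        WithSeminorms.continuous_of_isBounded
          (ContDiffMapSupportedIn.withSeminorms ℝ E (Covector E m) ⊤ K₀)
          (norm_withSeminorms ℝ ℝ) ℓ (.of_real fun _ => ⟨{0}, (M j₀).toReal, fun ψ => by
              show ‖L (TestFunction.ofSupportedIn hK₀ ψ)‖ ≤ _
              rw [Real.norm_eq_abs, Finset.sup_singleton]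
              have hb : ∀ y, ‖(TestFunction.ofSupportedIn hK₀ ψ : TestForm Ω m) y‖ ≤
                  ContDiffMapSupportedIn.seminorm ℝ E (Covector E m) ⊤ K₀ 0 ψ := fun y => by
                have := ContDiffMapSupportedIn.norm_iteratedFDeriv_apply_le_seminorm ℝ
                  (n := ⊤) (i := 0) (mod_cast le_top) (f := ψ) (x := y)
                rwa [norm_iteratedFDeriv_zero] at this
              have hsup : tsupport ⇑(TestFunction.ofSupportedIn hK₀ ψ : TestForm Ω m) ⊆
                  closure (V j₀) := by
                refine (closure_minimal (fun x hx => ?_) K₀.isCompact.isClosed).trans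
                  (hj₀.trans ((hKV j₀).trans subset_closure))
                by_contra h
                exact hx (ψ.zero_on_compl h)
              have h := hLbound j₀ _ hsup _ (apply_nonneg _ _) hb
              linarith [h]⟩)
      exact hcont
  exact ⟨T', ι, hι, fun φ => hL φ⟩

end Literature.Geometry.GeometricMeasureTheory

end
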